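import Literature.NumberTheory.ComplexMultiplication.SharedImaginaryQuadraticDegenerate
import HarnessLib

/-!
# Two simple CM abelian varieties whose CM fields share an imaginary quadratic field: exceptional Hodge classes are
# FORCED on some product `∏ A_i^{k_i}` (the Weil classes of the shared field), even when each factor is nondegenerate

COR-CM (cell `pub-hodgecm2`, binder seat `b23` gen 28), count-neutral; NEW as stated, hence under `Summits/`.  The
negative companion of `Summits/HodgeConjecture/CorCM/RealIntersectionCMFieldsHodge` (partial conjugations — Galois
closures meeting in TOTALLY REAL fields — give `B• = D•` and the Hodge conjecture on every `∏_i A_i^{k_i}`).  The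
literature file `Literature.NumberTheory.ComplexMultiplication.SharedImaginaryQuadraticDegenerate` (this seat) shows that
when two of the CM fields `K_{i₀}`, `K_{i₁}` contain a common imaginary quadratic field `k` (embeddings `j₀`, `j₁`) and both
SIGNATURE DEFECTS of the types on `k` are non-zero (automatic for odd `[K_{i_κ} : k]`), the family `(Φ_i)` is DEGENERATE,
whatever the types.  With the tree's Hazama–Murty theorem for separating families
(`Pohlmann1968.CMAlgebra.exists_exceptional_prod_of_not_isNondegenerateFamily`) this file records the geometric upshot:

* **`exists_exceptional_prod_of_shared_quadratic`** — for a SEPARATING family (simple, pairwise CM-inequivalent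
  factors) of realisations, some product `⨁_{j<N} A_{π j}` carries a rational `(m,m)`-class OUTSIDE `Dᵐ ⊗ ℂ` — an
  exceptional Hodge class (a Weil class for `k`);
* **`exists_exceptional_prod_of_shared_quadratic_of_odd`** — the same under the degree condition
  `[K_{i₀} : ℚ]/2`, `[K_{i₁} : ℚ]/2` odd (e.g. two simple CM threefolds with different cyclic sextic CM fields through the same
  imaginary quadratic field: `ℚ(ζ_7)` and `ℚ(√−7)·ℚ(ζ_9)⁺`; or a CM elliptic curve `E_k` and a simple `A` with `k ⊆ End⁰(A)`
  of odd relative degree);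
* **`not_forall_prod_hodgeClassSpan_eq_of_shared_quadratic`** — `B• = D•` FAILS on some such product.

So for two-field products the partial-conjugation criterion is sharp in this direction: a shared imaginary quadratic
field with unbalanced signatures is exactly where the divisor regime ends and the (open) Weil-class regime begins.
Theorems only, no definition, no `sorry`; the exceptional classes are NOT claimed algebraic or non-algebraic.

## References

* [Gordon1999HodgeAVSurvey] B. B. Gordon, *A survey of the Hodge conjecture for abelian varieties*, 7.5–7.7 (Murty,
  Hazama), §3 Theorem (proof).
* [Deligne1982HodgeCycles] P. Deligne, *Hodge cycles on abelian varieties*, LNM 900 (1982), §4 (Weil classes).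

Provenance: Literature home (family `hodge`, namespace `Literature.NumberTheory.ComplexMultiplication.SharedQuadraticExotic`) of the Summits-side `CorCM/SharedImaginaryQuadraticExotic` (cell `pub-hodgecm2`, COR-CM; all its imports are `Literature/` and Mathlib), which `Literature/` may not import; theorems only, no named fact, no definition. Nothing here bears on `HC_CM`. Lane `lit-hodgefound` (Layer A3: CM types, their Kubota ranks and Galois combinatorics), seat p20.
-/

noncomputable section

open _root_.CategoryTheory _root_.CategoryTheory.Limits NumberField NumberField.ComplexEmbedding Module

namespace Literature.NumberTheory.ComplexMultiplication.SharedQuadraticExotic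

open Literature.NumberTheory.ComplexMultiplication
open Literature.AlgebraicGeometry.Motives (AbelianVariety CMType)
open Literature.AlgebraicGeometry.HodgeTheory
open Literature.AlgebraicGeometry.ComplexMultiplication (IsCMTypeRealisation)
open Literature.AlgebraicGeometry.VanGeemen1994 (hodgeClassSpan)
open Literature.AlgebraicGeometry.Pohlmann1968
open Literature.Barriers.HodgeConjecture (divisorClassesSpan)

section Geometry

variable {I : Type} {K : I → Type} [∀ i, Field (K i)] [∀ i, NumberField (K i)] [∀ i, IsCMField (K i)] [Fintype I]
  [Nonempty I] {Φ : ∀ i, CMType (K i)}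
variable {A : I → AbelianVariety ℂ} {ι : ∀ i, 𝓞 (K i) →+* End (A i)}
  {θ : ∀ i, K i →+* Module.End ℂ (complexBetti (A i).X 1)}
variable {k : Type} [Field k] [NumberField k] [IsTotallyComplex k]

open scoped Classical in
/-- **A shared imaginary quadratic field forces an exceptional Hodge class.**  Let `(K_i; Φ_i)` be a separating family
(simple, pairwise CM-inequivalent realisations `A_i`), `k` imaginary quadratic with embeddings `j₀ : k → K_{i₀}`,
`j₁ : k → K_{i₁}` (`i₀ ≠ i₁`) and a complex embedding `ι₀`, and suppose both signature defects
`Σ_{φ ∈ Φ_{i_κ}} sign(φ|_k)` are non-zero.  Then some product `⨁_{j<N} A_{π j}` carries a rational `(m,m)`-class outside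
`Dᵐ ⊗ ℂ`. [cite: Gordon1999HodgeAVSurvey, 7.5] [cite: Deligne1982HodgeCycles, §4] -/
theorem exists_exceptional_prod_of_shared_quadratic (hsep : CMAlgebra.IsSeparatingFamily Φ) (hk : finrank ℚ k = 2)
    (ι₀ : k →+* ℂ) {i₀ i₁ : I} (h01 : i₀ ≠ i₁) (j₀ : k →+* K i₀) (j₁ : k →+* K i₁)
    (hd₀ : ∑ φ ∈ Finset.univ.filter (fun φ : K i₀ →+* ℂ => φ ∈ (Φ i₀).1),
      (if φ.comp j₀ = ι₀ then (1 : ℚ) else -1) ≠ 0)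
    (hd₁ : ∑ φ ∈ Finset.univ.filter (fun φ : K i₁ →+* ℂ => φ ∈ (Φ i₁).1),
      (if φ.comp j₁ = ι₀ then (1 : ℚ) else -1) ≠ 0)
    (hA : ∀ i, IsCMTypeRealisation (Φ i) (A i) (ι i) (θ i)) :
    ∃ (N : ℕ) (π : Fin N → I) (m : ℕ) (c : complexBetti (⨁ fun j : Fin N => A (π j)).X (2 * m)),
      IsRationalClass c ∧
      IsOfHodgeType (⨁ fun j : Fin N => A (π j)).dim (⨁ fun j : Fin N => A (π j)).X (2 * m) m m c ∧
      c ∉ divisorClassesSpan (⨁ fun j : Fin N => A (π j)).X (⨁ fun j : Fin N => A (π j)).dim m :=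
  CMAlgebra.exists_exceptional_prod_of_not_isNondegenerateFamily hsep
    (not_isNondegenerateFamily_of_shared_quadratic hk ι₀ h01 j₀ j₁ Φ hd₀ hd₁) hA

/-- **Odd relative degrees force an exceptional Hodge class**: a separating family two of whose CM fields contain the
imaginary quadratic field `k` with `[K_{i₀} : ℚ]/2` and `[K_{i₁} : ℚ]/2` odd (e.g. two simple CM threefolds with different
cyclic sextic CM fields through `k`, for ANY types; `E_k × A` with `k ⊆ K_A` of odd relative degree) has a product
`⨁_{j<N} A_{π j}` with a rational `(m,m)`-class outside `Dᵐ ⊗ ℂ`. [cite: Gordon1999HodgeAVSurvey, 7.5] [cite: Deligne1982HodgeCycles, §4] -/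
theorem exists_exceptional_prod_of_shared_quadratic_of_odd (hsep : CMAlgebra.IsSeparatingFamily Φ)
    (hk : finrank ℚ k = 2) (ι₀ : k →+* ℂ) {i₀ i₁ : I} (h01 : i₀ ≠ i₁) (j₀ : k →+* K i₀) (j₁ : k →+* K i₁)
    (h₀ : Odd (finrank ℚ (K i₀) / 2)) (h₁ : Odd (finrank ℚ (K i₁) / 2))
    (hA : ∀ i, IsCMTypeRealisation (Φ i) (A i) (ι i) (θ i)) :
    ∃ (N : ℕ) (π : Fin N → I) (m : ℕ) (c : complexBetti (⨁ fun j : Fin N => A (π j)).X (2 * m)),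
      IsRationalClass c ∧
      IsOfHodgeType (⨁ fun j : Fin N => A (π j)).dim (⨁ fun j : Fin N => A (π j)).X (2 * m) m m c ∧
      c ∉ divisorClassesSpan (⨁ fun j : Fin N => A (π j)).X (⨁ fun j : Fin N => A (π j)).dim m :=
  CMAlgebra.exists_exceptional_prod_of_not_isNondegenerateFamily hsep
    (not_isNondegenerateFamily_of_shared_quadratic_of_odd hk ι₀ h01 j₀ j₁ h₀ h₁ Φ) hA

/-- **`B• = D•` fails on some product** of a separating family through a shared imaginary quadratic field with odd
relative degrees: not every `Bᵐ(⨁_{j<N} A_{π j}) ⊗ ℂ` equals `Dᵐ ⊗ ℂ` — in contrast with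
`hodgeClassSpan_prod_eq_divisorClassesSpan_of_conj_apply_eq` for Galois closures meeting in totally real fields.
[cite: Gordon1999HodgeAVSurvey, 7.5] -/
theorem not_forall_prod_hodgeClassSpan_eq_of_shared_quadratic_of_odd (hsep : CMAlgebra.IsSeparatingFamily Φ)
    (hk : finrank ℚ k = 2) (ι₀ : k →+* ℂ) {i₀ i₁ : I} (h01 : i₀ ≠ i₁) (j₀ : k →+* K i₀) (j₁ : k →+* K i₁)
    (h₀ : Odd (finrank ℚ (K i₀) / 2)) (h₁ : Odd (finrank ℚ (K i₁) / 2))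
    (hA : ∀ i, IsCMTypeRealisation (Φ i) (A i) (ι i) (θ i)) :
    ¬ ∀ (N : ℕ) (π : Fin N → I) (m : ℕ),
      hodgeClassSpan (⨁ fun j : Fin N => A (π j)).dim (⨁ fun j : Fin N => A (π j)).X m =
        divisorClassesSpan (⨁ fun j : Fin N => A (π j)).X (⨁ fun j : Fin N => A (π j)).dim m := fun h =>
  not_isNondegenerateFamily_of_shared_quadratic_of_odd hk ι₀ h01 j₀ j₁ h₀ h₁ Φ
    ((CMAlgebra.isNondegenerateFamily_iff_forall_prod_hodgeClassSpan_eq hsep hA).2 h)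

end Geometry

end Literature.NumberTheory.ComplexMultiplication.SharedQuadraticExotic

end
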